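import Summits.PneNP.PneNP.Theorems.SymmetryBudgetNoHiddenOrderBranchSumHub
import Summits.PneNP.PneNP.Theorems.SymmetryBudgetNoHiddenOrderPerPathPotential

/-!
# Few fat nodes on a refinement path: `(θ_D - 1) · D ≤ 2|V|` (per-path Corneil–Goldberg bound, `NoHiddenOrder`)

Route `PneNP/SymmetryBudget`, `NoHiddenOrder` (stmt-PneNP-14781); memo `PER-PATH.md` §10, Theorem B, over seat -2's abstract
`BranchSum.RefinementPath` (H1–H5 of CG84-FLATNESS §9.3: nested vertex sets and cells, equitability, connected switching graph in
cut form, homogeneity of removed vertices towards later cells, progress). For such a path `R` of length `N` and a threshold `D`: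

* `RefinementPath.not_swAdj_of_removed_lt` — a vertex removed between nodes `k < k'` has no node-`k` switching edge to a vertex
  whose node-`k` cell keeps more than half of itself as ONE node-`k'` cell (the file `…BranchSumHub` has the case `k' = k+1`);
* `RefinementPath.exists_split_or_heavy` — hence between any two nodes `k < k' < N` some node-`k` cell SPLITS at node `k'` or loses
  at least half of its vertices (switching closure: otherwise the removed set would have no outgoing switching edge, contradicting
  the connectivity cut H3);
* `RefinementPath.card_fat_mul_le` — **the nodes with `d k > D` number `θ_D` with `(θ_D - 1) · D ≤ 2 · |V|`**: the fat nodes form a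
  fat chain in the sense of `PerPath.fatChain_length_le` (`…PerPathPotential.lean`).

With `D = n/q` this is `θ_q ≤ 2q + 1`, replacing Laubner's Prop. 3.5.2 (`θ_q < q`, whose proof has a debris gap) by a correct
statement with constant 2; summing dyadically gives `Σ_k log₂ d_k = O(|V|)` per path (`…PerPathEntropy.lean`). No definitions.
-/

-- `Summit.PneNP.PneNP.…` duplicates `PneNP` BY DESIGN (single-problem summit, D-0017 layout).
set_option linter.dupNamespace false

namespace Summit.PneNP.PneNP.Theorems

open Finset

namespace BranchSum

variable {V : Type*} [DecidableEq V] {G : SimpleGraph V} [DecidableRel G.Adj] {N : ℕ}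

namespace RefinementPath

variable (R : RefinementPath G N)

/-- A vertex removed between nodes `k < k'` has no node-`k` switching edge to a vertex `y ∈ W k'` whose node-`k` cell is less
than twice its node-`k'` cell (generalises `not_swAdj_of_removed`, the case `k' = k + 1`). -/
theorem not_swAdj_of_removed_lt {k k' : ℕ} (hkk' : k < k') {v y : V} (hv : v ∈ R.W k) (hv' : v ∉ R.W k')
    (hy : y ∈ R.W k') (hgiant : (R.cell k y).card < 2 * (R.cell k' y).card) : ¬ (R.sw k).Adj v y := by
  intro hadj
  have hyk : y ∈ R.W k := R.W_subset_of_le hkk'.le hy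
  have hYC : R.cell k' y ⊆ R.cell k y := R.cell_subset_cell_of_le hkk'.le hy
  have hhom := R.removal k k' hkk' v hv hv' y hy
  -- every vertex of the later cell is a switching-neighbour of `v`
  have hall : R.cell k' y ⊆ (R.cell k y).filter fun t => (R.sw k).Adj v t := by
    intro y' hy'
    have hy'W : y' ∈ R.W k' := R.cell_subset_W k' y hy'
    refine mem_filter.2 ⟨hYC hy', R.swAdj_iff_of_homogeneous ?_ ?_ ?_ hadj⟩
    · exact (R.mem_cell_iff.1 (hYC hy')).2
    · rintro rfl; exact hv' hy'W
    · rcases hhom with h | h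
      · exact iff_of_true (h y' hy') (h y (R.self_mem_cell hy))
      · exact iff_of_false (h y' hy') (h y (R.self_mem_cell hy))
  have h1 := card_le_card hall
  have h2 := R.two_mul_swDeg_le k hv hyk
  omega

/-- **Progress between two nodes** (PER-PATH.md Theorem B (2), switching closure): for `k < k' < N` some node-`k` cell
contains two vertices of `W k'` in different node-`k'` cells (a SPLIT), or at most half of it survives to node `k'` (a HEAVY
loss). Otherwise every removed vertex would lack switching edges to `W k'`, and the removed set — non-empty by H5, proper
because `W k' ≠ ∅` — would violate the connectivity cut H3. -/
theorem exists_split_or_heavy {k k' : ℕ} (hkk' : k < k') (hk' : k' < N) :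
    ∃ x ∈ R.W k, (∃ u ∈ R.W k', ∃ v ∈ R.W k', R.col k u = R.col k x ∧ R.col k v = R.col k x ∧ R.col k' u ≠ R.col k' v) ∨
      (R.cell k x).card ≤ 2 * ((R.cell k x).filter fun w => w ∉ R.W k').card := by
  by_contra h
  push Not at h
  have hk : k < N := hkk'.trans hk'
  -- the removed set is a non-empty proper subset of `W k`
  set S : Finset V := (R.W k).filter fun w => w ∉ R.W k' with hS
  obtain ⟨x, hx, hx'⟩ := R.exists_removed hk
  have hxS : x ∈ S := mem_filter.2 ⟨hx, fun hxk' => hx' (R.W_subset_of_le (Nat.succ_le_of_lt hkk') hxk')⟩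
  obtain ⟨y₀, hy₀, -⟩ := R.exists_removed hk'
  have hSne : S ≠ R.W k := by
    intro hSW
    have : y₀ ∈ S := hSW ▸ R.W_subset_of_le hkk'.le hy₀
    exact (mem_filter.1 this).2 hy₀
  obtain ⟨a, ha, b, hb, hab⟩ := R.connected k S (filter_subset _ _) ⟨x, hxS⟩ hSne
  rw [mem_sdiff] at hb
  have haW : a ∈ R.W k := (mem_filter.1 ha).1
  have haW' : a ∉ R.W k' := (mem_filter.1 ha).2
  have hbW' : b ∈ R.W k' := by
    by_contra hbW'
    exact hb.2 (mem_filter.2 ⟨hb.1, hbW'⟩)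
  -- the cell of `b` neither splits nor is heavy: it keeps more than half of itself as one node-`k'` cell
  obtain ⟨hnosplit, hnotheavy⟩ := h b hb.1
  have hsub : (R.cell k b).filter (fun w => w ∈ R.W k') ⊆ R.cell k' b := by
    intro w hw
    rw [mem_filter] at hw
    rw [R.mem_cell_iff] at hw ⊢
    exact ⟨hw.2, hnosplit w hw.2 b hbW' hw.1.2 rfl⟩
  have hsplit := card_filter_add_card_filter_not (s := R.cell k b) (fun w => w ∈ R.W k')
  have h1 := card_le_card hsub
  have hgiant : (R.cell k b).card < 2 * (R.cell k' b).card := by omega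
  exact R.not_swAdj_of_removed_lt hkk' haW haW' hbW' hgiant hab

section Count

variable [Fintype V]

/-- **Few fat nodes** (PER-PATH.md Theorem B (3)): the nodes `k < N` with `d k > D` number `θ` with `(θ - 1) · D ≤ 2|V|`. -/
theorem card_fat_mul_le (D : ℕ) :
    (((range N).filter fun k => D < R.d k).card - 1) * D ≤ 2 * Fintype.card V := by
  classical
  set F : Finset ℕ := (range N).filter fun k => D < R.d k with hF
  set M := F.card with hM
  -- enumerate the fat nodes increasingly and extend by `N`
  let e : Fin M ↪o ℕ := F.orderEmbOfFin rfl
  let idx : ℕ → ℕ := fun i => if h : i < M then e ⟨i, h⟩ else N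
  have hidx_mem : ∀ i (h : i < M), idx i ∈ F := fun i h => by
    simp only [idx, dif_pos h]; exact F.orderEmbOfFin_mem rfl _
  have hidx_lt : ∀ i, i + 1 < M → idx i < idx (i + 1) := fun i h => by
    have h0 : i < M := by omega
    simp only [idx, dif_pos h, dif_pos h0]
    exact e.strictMono (Fin.mk_lt_mk.2 (Nat.lt_succ_self i))
  have hidx_N : ∀ i, i < M → idx i < N := fun i h => (mem_range.1 (mem_filter.1 (hidx_mem i h)).1)
  have hidx_fat : ∀ i, i < M → D < R.d (idx i) := fun i h => (mem_filter.1 (hidx_mem i h)).2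
  -- the fat chain
  have key := PerPath.fatChain_length_le (fun i => R.W (idx i)) (fun i => R.col (idx i)) M D
    (fun i hi => R.W_subset_of_le (hidx_lt i hi).le)
    (fun i hi x hx y hy hxy => R.col_eq_of_le (hidx_lt i hi).le hx hy hxy)
    (fun i hi x hx => (hidx_fat i hi).trans_le (R.d_le (idx i) x hx))
    (fun i hi => R.exists_split_or_heavy (hidx_lt i hi) (hidx_N (i + 1) hi))
  exact key.trans (Nat.mul_le_mul_left 2 (card_le_univ _))

end Count

end RefinementPath

end BranchSum

end Summit.PneNP.PneNP.Theorems
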